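import Literature.Analysis.FunctionSpaces.TorusFormsFibreAveraging
import Literature.Analysis.FunctionSpaces.TorusPeriodicLocalization
import Literature.NumberTheory.Transcendental.FormIntegrationCharts
import HarnessLib

/-!
# Averaging a smooth form along a lattice of directions: the average is smooth, and for a closed form it is
# cohomologous to the form by an explicit smooth homotopy (transport of `TorusFormsFibreAveraging` through an
# affine-cored periodic chart)

Analysis/FunctionSpaces support file (everything proved; definitions with bodies, no named fact), the generic form of
the transport carried out for the cusp stabilizer of a Hilbert modular group in
`Literature.Geometry.Kaehler.ComplexTorusHilbertModularCuspStabilizerTranslationAverage` (there: the `x`-torus `ℝⁿ/t`,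
smoothness on `ℍⁿ` only). Here the setting is a finite-dimensional real normed space `P` with a linear chart
`Φ : ℝ^{ι₁ ⊕ ι₂} ≃ P`; the LATTICE DIRECTIONS are `dirVec Φ s = Φ(s ⊕ 0)`, `s ∈ ℝ^{ι₁}`, and a form
`η : P → P[⋀^{p+1}] → ℂ` is DIRECTION-PERIODIC if `η(q + dirVec Φ e_j) = η(q)` for the unit vectors `e_j` of `ℤ^{ι₁}`.
For such `η`, smooth on all of `P`, we define

* the slice `dslice Φ η q : T^{ι₁} → …`, `t ↦ η(q + dirVec Φ t)`, the **direction average**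
  `davg Φ η q = ∫_{T^{ι₁}} η(q + dirVec Φ t) dt`, the Fourier coefficients `dcoeff Φ η k q`, and for a normalised weight
  family `W : ℤ^{ι₁} → ℝ^{ι₁}` of polynomial growth (e.g. `stdWeight k = k/|k|²`) the **homotopy**
  `dhom Φ W η q = Σ_{k ≠ 0} (2πi)⁻¹ (dirVec Φ W_k) ⌟ dcoeff Φ η k q`,

and prove: translation rules along the directions, inheritance of periodicity, absolute convergence, **`davg Φ η` and
`dhom Φ W η` are `C^∞` on `P`**, **`d(dhom Φ W η) = η − davg Φ η` everywhere when `dη = 0`**, and **equivariance**: if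
`η(q) = η(Dq + c) ∘ D` for an affine map whose linear part `D` fixes every direction `dirVec Φ s`, then `davg Φ η` and
`dhom Φ W η` satisfy the same identity. The proofs transport the torus engine `Torus.extD_fibreHom_add_fibreHom_extD`
through the chart `(s, u) ↦ q₀ + Φ(s ⊕ φ(u))`, `φ` the smooth `ℤ^{ι₂}`-periodic profile equal to the identity near `0`
(`Torus.perSum` of a bump): the chart is affine with linear part `Φ` on the core `|u| < 1/8`, the pulled-back form is
globally smooth, periodic and closed, and its fibre average ∕ homotopy on the core are `davg` ∕ `dhom` read through `Φ`.

## References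
* [BottTu1982Forms] R. Bott, L. Tu, *Differential Forms in Algebraic Topology*, GTM 82 (1982), §I.4 (homotopy operators,
  `d` commutes with pullback).
* [Freitag1990] E. Freitag, *Hilbert Modular Forms*, Springer (1990), Ch. III §2, proof of Prop. 2.1, pp. 144–145
  (Fourier expansion along a torus of directions; the coefficients of a closed invariant form «do not depend on `x`»).
* [Grafakos2014] L. Grafakos, *Classical Fourier Analysis*, 3rd ed. (2014), §3.1.1, §3.3.3.
-/

noncomputable section

/- Instance search through the form spaces `P [⋀^Fin p]→L[ℝ] ℂ` (complex scalars acting on real-alternating maps) nests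
pending instance problems three deep; Lean's default depth is 1 (as in `TorusFormsFibreAveraging`). -/
set_option maxSynthPendingDepth 3

open scoped Classical Topology ContDiff
open Set Function Filter MeasureTheory Complex ContinuousAlternatingMap UnitAddTorus

namespace Literature.Analysis.FunctionSpaces

namespace Torus

open Literature.NumberTheory.Transcendental (ContDiffAt.continuousAlternatingMapCompContinuousLinearMap)
open Literature.LinearAlgebra.Alternating (curryLeft_smul')

variable {ι₁ ι₂ : Type*} [Fintype ι₁] [Fintype ι₂]
variable {P : Type*} [NormedAddCommGroup P] [NormedSpace ℝ P]

/-! ## §1 Coordinates of `ℝ^{ι₁ ⊕ ι₂}`, the directions `dirVec Φ`, direction-periodicity -/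

section Coordinates

/-- The `ι₁`-coordinates of `ℝ^{ι₁ ⊕ ι₂}`. [folklore] -/
def sPartL : EuclideanSpace ℝ (ι₁ ⊕ ι₂) →L[ℝ] EuclideanSpace ℝ ι₁ :=
  (EuclideanSpace.equiv ι₁ ℝ).symm.toContinuousLinearMap.comp
    (ContinuousLinearMap.pi fun j : ι₁ =>
      (EuclideanSpace.proj (Sum.inl j : ι₁ ⊕ ι₂) : EuclideanSpace ℝ (ι₁ ⊕ ι₂) →L[ℝ] ℝ))

/-- The `ι₂`-coordinates of `ℝ^{ι₁ ⊕ ι₂}`. [folklore] -/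
def uPartL : EuclideanSpace ℝ (ι₁ ⊕ ι₂) →L[ℝ] EuclideanSpace ℝ ι₂ :=
  (EuclideanSpace.equiv ι₂ ℝ).symm.toContinuousLinearMap.comp
    (ContinuousLinearMap.pi fun i : ι₂ =>
      (EuclideanSpace.proj (Sum.inr i : ι₁ ⊕ ι₂) : EuclideanSpace ℝ (ι₁ ⊕ ι₂) →L[ℝ] ℝ))

omit [Fintype ι₁] [Fintype ι₂] in
/-- `(sPartL z)_j = z_{inl j}`. [cite: Grafakos2014, §3.1.1 (`ℝⁿ`, `Tⁿ = ℝⁿ/ℤⁿ`, coordinates)] -/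
@[simp]
theorem sPartL_apply (z : EuclideanSpace ℝ (ι₁ ⊕ ι₂)) (j : ι₁) : sPartL z j = z (Sum.inl j) := rfl

omit [Fintype ι₁] [Fintype ι₂] in
/-- `(uPartL z)_i = z_{inr i}`. [cite: Grafakos2014, §3.1.1 (`ℝⁿ`, `Tⁿ = ℝⁿ/ℤⁿ`, coordinates)] -/
@[simp]
theorem uPartL_apply (z : EuclideanSpace ℝ (ι₁ ⊕ ι₂)) (i : ι₂) : uPartL z i = z (Sum.inr i) := rfl

/-- `(a, b) ↦ a ⊕ b ∈ ℝ^{ι₁ ⊕ ι₂}`. [folklore] -/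
def joinE (a : EuclideanSpace ℝ ι₁) (b : EuclideanSpace ℝ ι₂) : EuclideanSpace ℝ (ι₁ ⊕ ι₂) :=
  WithLp.toLp 2 (Sum.elim a.ofLp b.ofLp)

omit [Fintype ι₁] [Fintype ι₂] in
/-- `(a ⊕ b)_{inl j} = a_j`. [cite: Grafakos2014, §3.1.1 (`ℝⁿ`, `Tⁿ = ℝⁿ/ℤⁿ`, coordinates)] -/
@[simp]
theorem joinE_apply_inl (a : EuclideanSpace ℝ ι₁) (b : EuclideanSpace ℝ ι₂) (j : ι₁) : joinE a b (Sum.inl j) = a j := rfl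

omit [Fintype ι₁] [Fintype ι₂] in
/-- `(a ⊕ b)_{inr i} = b_i`. [cite: Grafakos2014, §3.1.1 (`ℝⁿ`, `Tⁿ = ℝⁿ/ℤⁿ`, coordinates)] -/
@[simp]
theorem joinE_apply_inr (a : EuclideanSpace ℝ ι₁) (b : EuclideanSpace ℝ ι₂) (i : ι₂) : joinE a b (Sum.inr i) = b i := rfl

omit [Fintype ι₁] [Fintype ι₂] in
/-- `sPartL (a ⊕ b) = a`. [cite: Grafakos2014, §3.1.1 (`ℝⁿ`, `Tⁿ = ℝⁿ/ℤⁿ`, coordinates)] -/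
@[simp]
theorem sPartL_joinE (a : EuclideanSpace ℝ ι₁) (b : EuclideanSpace ℝ ι₂) : sPartL (joinE a b) = a := by
  ext j; rfl

omit [Fintype ι₁] [Fintype ι₂] in
/-- `uPartL (a ⊕ b) = b`. [cite: Grafakos2014, §3.1.1 (`ℝⁿ`, `Tⁿ = ℝⁿ/ℤⁿ`, coordinates)] -/
@[simp]
theorem uPartL_joinE (a : EuclideanSpace ℝ ι₁) (b : EuclideanSpace ℝ ι₂) : uPartL (joinE a b) = b := by
  ext i; rfl

omit [Fintype ι₁] [Fintype ι₂] in
/-- `z = sPartL z ⊕ uPartL z`. [cite: Grafakos2014, §3.1.1 (`ℝⁿ`, `Tⁿ = ℝⁿ/ℤⁿ`, coordinates)] -/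
theorem joinE_sPartL_uPartL (z : EuclideanSpace ℝ (ι₁ ⊕ ι₂)) : joinE (sPartL z) (uPartL z) = z := by
  ext i
  cases i with
  | inl j => rfl
  | inr i => rfl

omit [Fintype ι₁] [Fintype ι₂] in
/-- `⊕` is additive. [cite: Grafakos2014, §3.1.1 (`ℝⁿ`, `Tⁿ = ℝⁿ/ℤⁿ`, coordinates)] -/
theorem joinE_add_joinE (a a' : EuclideanSpace ℝ ι₁) (b b' : EuclideanSpace ℝ ι₂) :
    joinE a b + joinE a' b' = joinE (a + a') (b + b') := by
  ext i
  cases i with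
  | inl j => rfl
  | inr i => rfl

omit [Fintype ι₁] [Fintype ι₂] in
/-- `⊕` is homogeneous. [cite: Grafakos2014, §3.1.1 (`ℝⁿ`, `Tⁿ = ℝⁿ/ℤⁿ`, coordinates)] -/
theorem smul_joinE (c : ℝ) (a : EuclideanSpace ℝ ι₁) (b : EuclideanSpace ℝ ι₂) : c • joinE a b = joinE (c • a) (c • b) := by
  ext i
  cases i with
  | inl j => rfl
  | inr i => rfl

omit [Fintype ι₁] [Fintype ι₂] in
/-- The torus point of `a ⊕ b` is `(proj a, proj b)`. [cite: Grafakos2014, §3.1.1 (`ℝⁿ`, `Tⁿ = ℝⁿ/ℤⁿ`, coordinates)] -/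
theorem proj_joinE (a : EuclideanSpace ℝ ι₁) (b : EuclideanSpace ℝ ι₂) :
    Torus.proj (joinE a b) = Sum.elim (Torus.proj a) (Torus.proj b) := by
  funext i
  cases i with
  | inl j => rfl
  | inr i => rfl

omit [Fintype ι₁] [Fintype ι₂] in
/-- `e_{inl j} = e_j ⊕ 0`. [cite: Grafakos2014, §3.1.1 (`ℝⁿ`, `Tⁿ = ℝⁿ/ℤⁿ`, coordinates)] -/
theorem single_inl_eq [DecidableEq ι₁] [DecidableEq ι₂] (j : ι₁) :
    EuclideanSpace.single (Sum.inl j : ι₁ ⊕ ι₂) (1 : ℝ) = joinE (EuclideanSpace.single j (1 : ℝ)) 0 := by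
  ext i
  cases i with
  | inl j' => simp
  | inr i => simp

omit [Fintype ι₁] [Fintype ι₂] in
/-- `e_{inr i} = 0 ⊕ e_i`. [cite: Grafakos2014, §3.1.1 (`ℝⁿ`, `Tⁿ = ℝⁿ/ℤⁿ`, coordinates)] -/
theorem single_inr_eq [DecidableEq ι₁] [DecidableEq ι₂] (i : ι₂) :
    EuclideanSpace.single (Sum.inr i : ι₁ ⊕ ι₂) (1 : ℝ) = joinE 0 (EuclideanSpace.single i 1) := by
  ext i'
  cases i' with
  | inl j => simp
  | inr i'' => simp

/-- `‖a ⊕ 0‖ = ‖a‖`. [cite: Grafakos2014, §3.1.1 (`ℝⁿ`, `Tⁿ = ℝⁿ/ℤⁿ`, coordinates)] -/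
theorem norm_joinE_zero (a : EuclideanSpace ℝ ι₁) : ‖joinE a (0 : EuclideanSpace ℝ ι₂)‖ = ‖a‖ := by
  simp [EuclideanSpace.norm_eq, Fintype.sum_sum_type]

/-- `a ↦ a ⊕ 0` as a continuous linear map. [folklore] -/
def inlL : EuclideanSpace ℝ ι₁ →L[ℝ] EuclideanSpace ℝ (ι₁ ⊕ ι₂) :=
  LinearMap.mkContinuous
    { toFun := fun a => joinE a 0
      map_add' := fun a a' => by
        rw [joinE_add_joinE, add_zero]
      map_smul' := fun c a => by rw [RingHom.id_apply, smul_joinE, smul_zero] }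
    1 fun a => by rw [one_mul]; exact (norm_joinE_zero a).le

/-- `inlL a = a ⊕ 0`. [cite: Grafakos2014, §3.1.1 (`ℝⁿ`, `Tⁿ = ℝⁿ/ℤⁿ`, coordinates)] -/
@[simp]
theorem inlL_apply (a : EuclideanSpace ℝ ι₁) : (inlL a : EuclideanSpace ℝ (ι₁ ⊕ ι₂)) = joinE a 0 := rfl

variable (Φ : EuclideanSpace ℝ (ι₁ ⊕ ι₂) ≃L[ℝ] P)

/-- **The lattice directions** of the chart `Φ`: `dirVec Φ s = Φ(s ⊕ 0)`. [cite: Freitag1990, Ch. III §2, p. 145] -/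
def dirVec : EuclideanSpace ℝ ι₁ →L[ℝ] P :=
  (Φ : EuclideanSpace ℝ (ι₁ ⊕ ι₂) →L[ℝ] P).comp inlL

/-- `dirVec Φ s = Φ (s ⊕ 0)`. [cite: Freitag1990, Ch. III §2, p. 145] -/
theorem dirVec_apply (s : EuclideanSpace ℝ ι₁) : dirVec Φ s = Φ (joinE s 0) := rfl

/-- **Direction-periodicity**: `η(q + dirVec Φ e_j) = η(q)` for the unit vectors of `ℤ^{ι₁}`.
[cite: Freitag1990, Ch. III §2, p. 144 («periodic»)] -/
def IsDirPeriodic [DecidableEq ι₁] {V : Type*} (η : P → V) : Prop :=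
  ∀ (j : ι₁) (q : P), η (q + dirVec Φ (EuclideanSpace.single j (1 : ℝ))) = η q

variable {Φ}

/-- A direction-periodic field is invariant under all integer combinations of the directions. [cite: Grafakos2014, §3.1.1] -/
theorem IsDirPeriodic.apply_add_dirVec_latticeVec [DecidableEq ι₁] {V : Type*} {η : P → V} (hη : IsDirPeriodic Φ η) (q : P)
    (s : EuclideanSpace ℝ ι₁) (m : ι₁ → ℤ) : η (q + dirVec Φ (s + Torus.latticeVec m)) = η (q + dirVec Φ s) := by
  have hper : Torus.IsLatticePeriodic fun s : EuclideanSpace ℝ ι₁ => η (q + dirVec Φ s) := by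
    intro j s
    simp only [map_add, ← add_assoc]
    exact hη j _
  exact Torus.IsLatticePeriodic.add_latticeVec_holds hper s m

end Coordinates

/-! ## §2 Slice, average, coefficients, homotopy along the directions -/

section Slice

variable [DecidableEq ι₁] {Φ : EuclideanSpace ℝ (ι₁ ⊕ ι₂) ≃L[ℝ] P}
variable {V : Type*} [NormedAddCommGroup V] [NormedSpace ℂ V]

variable (Φ) in
/-- **The slice of `η` through `q` along the directions**: `t ↦ η(q + dirVec Φ t)` on the torus `T^{ι₁}`.
[cite: Freitag1990, Ch. III §2, p. 145] -/
def dslice (η : P → V) (q : P) : UnitAddTorus ι₁ → V :=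
  fun t => η (q + dirVec Φ (Torus.repr t))

variable (Φ) in
/-- **The direction average** `davg Φ η q = ∫_{T^{ι₁}} η(q + dirVec Φ t) dt`. [cite: Freitag1990, Ch. III §2, p. 145] -/
def davg (η : P → V) (q : P) : V :=
  ∫ t, dslice Φ η q t

variable (Φ) in
/-- **The Fourier coefficients along the directions**. [cite: Freitag1990, Ch. III §2, p. 145] -/
def dcoeff (η : P → V) (k : ι₁ → ℤ) (q : P) : V :=
  mFourierCoeff (dslice Φ η q) k

variable (Φ) in
/-- The `k`-th term `(2πi)⁻¹ (dirVec Φ W_k) ⌟ dcoeff Φ η k q` of the homotopy. [cite: BottTu1982Forms, §I.4] -/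
def dhomTerm (W : (ι₁ → ℤ) → EuclideanSpace ℝ ι₁) {p : ℕ} (η : P → P [⋀^Fin (p + 1)]→L[ℝ] ℂ) (k : ι₁ → ℤ) (q : P) :
    P [⋀^Fin p]→L[ℝ] ℂ :=
  (2 * Real.pi * I : ℂ)⁻¹ • (dcoeff Φ η k q).curryLeft (dirVec Φ (W k))

variable (Φ) in
/-- **The homotopy** `dhom Φ W η q = Σ_k (2πi)⁻¹ (dirVec Φ W_k) ⌟ dcoeff Φ η k q`. [cite: BottTu1982Forms, §I.4] -/
def dhom (W : (ι₁ → ℤ) → EuclideanSpace ℝ ι₁) {p : ℕ} (η : P → P [⋀^Fin (p + 1)]→L[ℝ] ℂ) : P → P [⋀^Fin p]→L[ℝ] ℂ :=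
  fun q => ∑' k, dhomTerm Φ W η k q

/-- **Normalised weights**: `W_0 = 0` and `Σ_j k_j W_{k,j} = 1` for `k ≠ 0`. [cite: BottTu1982Forms, §I.4] -/
def IsNormalisedWeight (W : (ι₁ → ℤ) → EuclideanSpace ℝ ι₁) : Prop :=
  W 0 = 0 ∧ ∀ k : ι₁ → ℤ, k ≠ 0 → ∑ j, (k j : ℝ) * W k j = 1

/-- **Polynomial growth** of a weight family. [cite: Grafakos2014, §3.3.3 (polynomially bounded multipliers)] -/
def HasPolyGrowthWeight (W : (ι₁ → ℤ) → EuclideanSpace ℝ ι₁) : Prop :=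
  ∃ (C : ℝ) (s : ℕ), ∀ k, ‖W k‖ ≤ C * (1 + freqNormSq k) ^ s

/-- **The standard weights** `W_k = k/|k|²` (`0` for `k = 0`). [cite: BottTu1982Forms, §I.4] -/
def stdWeight (k : ι₁ → ℤ) : EuclideanSpace ℝ ι₁ :=
  (freqNormSq k)⁻¹ • WithLp.toLp 2 fun j => (k j : ℝ)

omit [DecidableEq ι₁] in
/-- The standard weights are normalised. [cite: BottTu1982Forms, §I.4] -/
theorem isNormalisedWeight_stdWeight : IsNormalisedWeight (stdWeight (ι₁ := ι₁)) := by
  refine ⟨by ext j; simp [stdWeight], fun k hk => ?_⟩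
  have h0 : freqNormSq k ≠ 0 := fun h => hk (by
    funext j
    have := Finset.sum_eq_zero_iff_of_nonneg (fun j _ => sq_nonneg (k j : ℝ)) |>.1 (by simpa [freqNormSq] using h) j
      (Finset.mem_univ j)
    exact_mod_cast (pow_eq_zero_iff two_ne_zero).1 this)
  simp only [stdWeight, PiLp.smul_apply, smul_eq_mul]
  rw [show (∑ j, (k j : ℝ) * ((freqNormSq k)⁻¹ * (k j : ℝ))) = (freqNormSq k)⁻¹ * ∑ j, (k j : ℝ) ^ 2 by
    rw [Finset.mul_sum]; exact Finset.sum_congr rfl fun j _ => by ring]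
  exact inv_mul_cancel₀ h0

omit [DecidableEq ι₁] in
/-- The standard weights have polynomial growth (`‖W_k‖ = |k|⁻¹ ≤ 1`). [cite: Grafakos2014, §3.3.3] -/
theorem hasPolyGrowthWeight_stdWeight : HasPolyGrowthWeight (stdWeight (ι₁ := ι₁)) := by
  refine ⟨1, 1, fun k => ?_⟩
  rw [stdWeight, norm_smul, norm_inv, Real.norm_eq_abs, abs_of_nonneg (freqNormSq_nonneg k), pow_one, one_mul]
  have hn : ‖(WithLp.toLp 2 fun j => (k j : ℝ) : EuclideanSpace ℝ ι₁)‖ ^ 2 = freqNormSq k := by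
    rw [EuclideanSpace.norm_eq, Real.sq_sqrt (Finset.sum_nonneg fun j _ => sq_nonneg _)]
    simp [freqNormSq]
  by_cases h0 : freqNormSq k = 0
  · rw [h0, inv_zero, zero_mul]
    positivity
  · have hpos : 0 < freqNormSq k := lt_of_le_of_ne (freqNormSq_nonneg k) (Ne.symm h0)
    have h1 : ‖(WithLp.toLp 2 fun j => (k j : ℝ) : EuclideanSpace ℝ ι₁)‖ ≤ freqNormSq k := by
      have hge1 : 1 ≤ freqNormSq k := by
        obtain ⟨j, hj⟩ : ∃ j, k j ≠ 0 := by
          by_contra h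
          push Not at h
          exact h0 (by simp [freqNormSq, h])
        have : (1 : ℝ) ≤ (k j : ℝ) ^ 2 := by
          have h1 : (1 : ℤ) ≤ |k j| := Int.one_le_abs hj
          have h2 : (1 : ℝ) ≤ |(k j : ℝ)| := by exact_mod_cast h1
          nlinarith [abs_nonneg (k j : ℝ), sq_abs (k j : ℝ)]
        exact this.trans (Finset.single_le_sum (fun i _ => sq_nonneg (k i : ℝ)) (Finset.mem_univ j))
      nlinarith [norm_nonneg (WithLp.toLp 2 fun j => (k j : ℝ) : EuclideanSpace ℝ ι₁), hn]
    calc (freqNormSq k)⁻¹ * ‖(WithLp.toLp 2 fun j => (k j : ℝ) : EuclideanSpace ℝ ι₁)‖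
        ≤ (freqNormSq k)⁻¹ * freqNormSq k := mul_le_mul_of_nonneg_left h1 (inv_nonneg.2 hpos.le)
      _ = 1 := inv_mul_cancel₀ h0
      _ ≤ 1 + freqNormSq k := by linarith [hpos.le]

omit [DecidableEq ι₁] [NormedAddCommGroup V] [NormedSpace ℂ V] in
/-- Unfolding the slice. [cite: Freitag1990, Ch. III §2, p. 145] -/
theorem dslice_apply (η : P → V) (q : P) (t : UnitAddTorus ι₁) : dslice Φ η q t = η (q + dirVec Φ (Torus.repr t)) := rfl

omit [NormedAddCommGroup V] [NormedSpace ℂ V] in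
/-- **The slice of a direction-periodic field lifts to `s ↦ η(q + dirVec Φ s)`**. [cite: Grafakos2014, §3.1.1] -/
theorem dslice_proj {η : P → V} (hη : IsDirPeriodic Φ η) (q : P) (s : EuclideanSpace ℝ ι₁) :
    dslice Φ η q (Torus.proj s) = η (q + dirVec Φ s) := by
  obtain ⟨m, hm⟩ := Torus.exists_repr_proj_eq_add_latticeVec_holds s
  rw [dslice_apply, hm, hη.apply_add_dirVec_latticeVec]

omit [NormedAddCommGroup V] [NormedSpace ℂ V] in
/-- `lift (dslice Φ η q) = (s ↦ η(q + dirVec Φ s))`. [cite: Grafakos2014, §3.1.1] -/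
theorem lift_dslice {η : P → V} (hη : IsDirPeriodic Φ η) (q : P) :
    Torus.lift (dslice Φ η q) = fun s => η (q + dirVec Φ s) :=
  funext fun s => dslice_proj hη q s

omit [NormedAddCommGroup V] [NormedSpace ℂ V] in
/-- **Translation rule for the slice**: `dslice η (q + dirVec s) = dslice η q (proj s + ·)`. [cite: Grafakos2014, §3.1.1] -/
theorem dslice_add_dirVec {η : P → V} (hη : IsDirPeriodic Φ η) (q : P) (s : EuclideanSpace ℝ ι₁) :
    dslice Φ η (q + dirVec Φ s) = fun t => dslice Φ η q (Torus.proj s + t) := by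
  funext t
  conv_rhs => rw [← Torus.proj_repr t, ← Torus.proj_add, dslice_proj hη]
  rw [dslice_apply, map_add, add_assoc]

omit [NormedSpace ℂ V] in
/-- The slice of a smooth periodic field is smooth. [cite: Grafakos2014, §3.1.1] -/
theorem isSmooth_dslice [NormedSpace ℝ V] {η : P → V} (hηs : ContDiff ℝ ∞ η) (hη : IsDirPeriodic Φ η) (q : P) :
    Torus.IsSmooth (dslice Φ η q) := by
  unfold Torus.IsSmooth
  rw [lift_dslice hη]
  exact hηs.comp (contDiff_const.add (dirVec Φ).contDiff)

/-- `e_{−k}(−x) = e_k(x)`. [folklore] -/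
private theorem mFourier_neg_neg {ι : Type*} [Fintype ι] (k : ι → ℤ) (x : UnitAddTorus ι) :
    mFourier (-k) (-x) = mFourier k x := by
  simp only [mFourier, ContinuousMap.coe_mk, Pi.neg_apply, fourier_apply, neg_smul, smul_neg, neg_neg]

/-- `e_k(0) = 1`. [folklore] -/
private theorem mFourier_apply_zero' {ι : Type*} [Fintype ι] (k : ι → ℤ) : mFourier k (0 : UnitAddTorus ι) = 1 := by
  simp only [mFourier, ContinuousMap.coe_mk, Pi.zero_apply, fourier_eval_zero, Finset.prod_const_one]

/-- **Translation rule for the coefficients**: `dcoeff η k (q + dirVec s) = e^{2πi k·s} · dcoeff η k q`.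
[cite: Grafakos2014, §3.1.1] -/
theorem dcoeff_add_dirVec {η : P → V} (hη : IsDirPeriodic Φ η) (k : ι₁ → ℤ) (q : P) (s : EuclideanSpace ℝ ι₁) :
    dcoeff Φ η k (q + dirVec Φ s) = mFourier k (Torus.proj s) • dcoeff Φ η k q := by
  simp only [dcoeff, Torus.mFourierCoeff_eq_integral_volume]
  rw [dslice_add_dirVec hη]
  have h1 : (fun t => mFourier (-k) t • dslice Φ η q (Torus.proj s + t)) =
      fun t => (fun t' => mFourier (-k) (t' - Torus.proj s) • dslice Φ η q t') (Torus.proj s + t) := by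
    funext t
    simp only [add_sub_cancel_left]
  have h2 := integral_add_left_eq_self (μ := (volume : Measure (UnitAddTorus ι₁)))
    (fun t' => mFourier (-k) (t' - Torus.proj s) • dslice Φ η q t') (Torus.proj s)
  rw [h1, h2, ← integral_smul]
  refine integral_congr_ae (Eventually.of_forall fun t => ?_)
  simp only
  rw [sub_eq_add_neg, Torus.mFourier_apply_add, mFourier_neg_neg, mul_comm, mul_smul]

/-- **The average is invariant along the directions**: `davg η (q + dirVec s) = davg η q`. [cite: Freitag1990, Ch. III §2, p. 145] -/
theorem davg_add_dirVec {η : P → V} (hη : IsDirPeriodic Φ η) (q : P) (s : EuclideanSpace ℝ ι₁) :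
    davg Φ η (q + dirVec Φ s) = davg Φ η q := by
  simp only [davg]
  rw [dslice_add_dirVec hη]
  exact integral_add_left_eq_self (μ := (volume : Measure (UnitAddTorus ι₁))) (dslice Φ η q) (Torus.proj s)

/-- `davg η` is again direction-periodic. [cite: Freitag1990, Ch. III §2, p. 145] -/
theorem isDirPeriodic_davg {η : P → V} (hη : IsDirPeriodic Φ η) : IsDirPeriodic Φ (davg Φ η) :=
  fun _ q => davg_add_dirVec hη q _

/-- The coefficients are direction-periodic (the character is `1` on the lattice). [cite: Grafakos2014, §3.1.1] -/
theorem isDirPeriodic_dcoeff {η : P → V} (hη : IsDirPeriodic Φ η) (k : ι₁ → ℤ) : IsDirPeriodic Φ (dcoeff Φ η k) := by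
  intro j q
  have h1 : (EuclideanSpace.single j (1 : ℝ) : EuclideanSpace ℝ ι₁) = Torus.latticeVec (Pi.single j 1) := by
    rw [Torus.latticeVec_single]
  rw [dcoeff_add_dirVec hη, h1, Torus.proj_latticeVec, mFourier_apply_zero', one_smul]

omit [DecidableEq ι₁] in
/-- The term `k = 0` vanishes when `W_0 = 0`. [folklore] -/
private theorem dhomTerm_zero {W : (ι₁ → ℤ) → EuclideanSpace ℝ ι₁} (hW0 : W 0 = 0) {p : ℕ} (η : P → P [⋀^Fin (p + 1)]→L[ℝ] ℂ)
    (q : P) : dhomTerm Φ W η 0 q = 0 := by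
  simp [dhomTerm, hW0]

/-- `dhom Φ W η` is direction-periodic. [cite: BottTu1982Forms, §I.4] -/
theorem isDirPeriodic_dhom (W : (ι₁ → ℤ) → EuclideanSpace ℝ ι₁) {p : ℕ} {η : P → P [⋀^Fin (p + 1)]→L[ℝ] ℂ}
    (hη : IsDirPeriodic Φ η) : IsDirPeriodic Φ (dhom Φ W η) := by
  intro j q
  simp only [dhom, dhomTerm, isDirPeriodic_dcoeff hη _ j q]

end Slice

/-! ## §3 Convergence of the homotopy series -/

section Convergence

variable [DecidableEq ι₁] {Φ : EuclideanSpace ℝ (ι₁ ⊕ ι₂) ≃L[ℝ] P}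

/-- `‖β ⌞ v‖ ≤ ‖β‖ ‖v‖`. [folklore] -/
private theorem norm_curryLeft_apply_le {E₁ : Type*} [NormedAddCommGroup E₁] [NormedSpace ℝ E₁] {q : ℕ}
    (β : E₁ [⋀^Fin (q + 1)]→L[ℝ] ℂ) (v : E₁) : ‖β.curryLeft v‖ ≤ ‖β‖ * ‖v‖ := by
  have := β.curryLeft.le_opNorm v
  rwa [norm_curryLeft] at this

/-- **The homotopy series converges absolutely** for a smooth periodic form (rapid decay of the coefficients of the
smooth slice against the polynomial growth of the weights). [cite: Grafakos2014, §3.3.3] -/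
theorem summable_dhomTerm {W : (ι₁ → ℤ) → EuclideanSpace ℝ ι₁} (hW : HasPolyGrowthWeight W) {p : ℕ}
    {η : P → P [⋀^Fin (p + 1)]→L[ℝ] ℂ} (hηs : ContDiff ℝ ∞ η) (hη : IsDirPeriodic Φ η) (q : P) :
    Summable fun k => dhomTerm Φ W η k q := by
  obtain ⟨C, s, hCW⟩ := hW
  have hc : Torus.RapidDecay (mFourierCoeff (dslice Φ η q)) := (isSmooth_dslice hηs hη q).rapidDecay_mFourierCoeff
  have hs : Summable fun k => ‖(2 * Real.pi * I : ℂ)⁻¹‖ * (‖dirVec Φ‖ * C) *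
      ((1 + freqNormSq k) ^ s * ‖mFourierCoeff (dslice Φ η q) k‖) := (hc s).mul_left _
  refine Summable.of_norm_bounded hs fun k => ?_
  rw [dhomTerm, norm_smul]
  have h1 : ‖(dcoeff Φ η k q).curryLeft (dirVec Φ (W k))‖ ≤ ‖dcoeff Φ η k q‖ * ‖dirVec Φ (W k)‖ :=
    norm_curryLeft_apply_le _ _
  have h2 : ‖dirVec Φ (W k)‖ ≤ ‖dirVec Φ‖ * (C * (1 + freqNormSq k) ^ s) :=
    ((dirVec Φ).le_opNorm _).trans (mul_le_mul_of_nonneg_left (hCW k) (norm_nonneg _))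
  have h3 : ‖dcoeff Φ η k q‖ = ‖mFourierCoeff (dslice Φ η q) k‖ := rfl
  calc ‖(2 * Real.pi * I : ℂ)⁻¹‖ * ‖(dcoeff Φ η k q).curryLeft (dirVec Φ (W k))‖
      ≤ ‖(2 * Real.pi * I : ℂ)⁻¹‖ * (‖dcoeff Φ η k q‖ * (‖dirVec Φ‖ * (C * (1 + freqNormSq k) ^ s))) :=
        mul_le_mul_of_nonneg_left (h1.trans (mul_le_mul_of_nonneg_left h2 (norm_nonneg _))) (norm_nonneg _)
    _ = ‖(2 * Real.pi * I : ℂ)⁻¹‖ * (‖dirVec Φ‖ * C) * ((1 + freqNormSq k) ^ s * ‖mFourierCoeff (dslice Φ η q) k‖) := by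
        rw [h3]; ring

/-- `dhom Φ W η q = Σ_k dhomTerm Φ W η k q` as a convergent series. [cite: BottTu1982Forms, §I.4] -/
theorem hasSum_dhom {W : (ι₁ → ℤ) → EuclideanSpace ℝ ι₁} (hW : HasPolyGrowthWeight W) {p : ℕ}
    {η : P → P [⋀^Fin (p + 1)]→L[ℝ] ℂ} (hηs : ContDiff ℝ ∞ η) (hη : IsDirPeriodic Φ η) (q : P) :
    HasSum (fun k => dhomTerm Φ W η k q) (dhom Φ W η q) :=
  (summable_dhomTerm hW hηs hη q).hasSum

end Convergence

/-! ## §4 The dirChart `(s, u) ↦ q₀ + Φ(s ⊕ φ(u))` -/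

section Chart

variable [DecidableEq ι₁] [DecidableEq ι₂]

/-- The bump with radii `1/8 < 1/4` on `ℝ^{ι₂}`. [folklore] -/
private def bump8 : ContDiffBump (0 : EuclideanSpace ℝ ι₂) := ⟨1 / 8, 1 / 4, by norm_num, by norm_num⟩

/-- **The periodic profile** `φ = perSum (bump • id)` on `ℝ^{ι₂}`: smooth, `ℤ^{ι₂}`-periodic, `φ(u) = u` for `‖u‖ ≤ 1/8`.
[folklore] -/
private def prof (u : EuclideanSpace ℝ ι₂) : EuclideanSpace ℝ ι₂ :=
  (0 : EuclideanSpace ℝ ι₂) + Torus.perSum (fun y => (bump8 (ι₂ := ι₂)) y • (y - 0)) u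

/-- The profile is smooth. [folklore] -/
private theorem contDiff_prof : ContDiff ℝ ∞ (prof (ι₂ := ι₂)) :=
  Torus.contDiff_localize (χ := bump8) (f := fun y => y) (0 : EuclideanSpace ℝ ι₂) contDiff_id

/-- The profile is `ℤ^{ι₂}`-periodic. [folklore] -/
private theorem isLatticePeriodic_prof : Torus.IsLatticePeriodic (prof (ι₂ := ι₂)) :=
  Torus.isLatticePeriodic_localize bump8 (fun y => y) 0

/-- The profile is the identity on `‖u‖ ≤ 1/8`. [folklore] -/
private theorem prof_eq_self {u : EuclideanSpace ℝ ι₂} (hu : ‖u‖ ≤ 1 / 8) : prof u = u := by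
  have h := Torus.localize_eq_of_norm_sub_le (χ := bump8 (ι₂ := ι₂)) (f := fun y => y) (0 : EuclideanSpace ℝ ι₂)
    (by show (1 : ℝ) / 4 ≤ 1 / 2; norm_num) 0 (x := u)
    (by rw [Torus.latticeVec_zero, sub_zero]; exact hu)
  rw [Torus.latticeVec_zero, sub_zero] at h
  exact h

variable (Φ : EuclideanSpace ℝ (ι₁ ⊕ ι₂) ≃L[ℝ] P)

/-- **The dirChart** `Θ(s, u) = q₀ + Φ(s ⊕ φ(u))`. [cite: Freitag1990, Ch. III §2, p. 144] -/
private def dirChart (q₀ : P) (z : EuclideanSpace ℝ (ι₁ ⊕ ι₂)) : P :=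
  q₀ + Φ (joinE (sPartL z) (prof (uPartL z)))

omit [DecidableEq ι₁] in
/-- The chart is smooth. [folklore] -/
private theorem contDiff_dirChart (q₀ : P) : ContDiff ℝ ∞ (dirChart Φ q₀) := by
  have h0 : ContDiff ℝ ∞ (uPartL (ι₁ := ι₁) (ι₂ := ι₂)) := (uPartL (ι₁ := ι₁) (ι₂ := ι₂)).contDiff
  have h1 : ContDiff ℝ ∞ fun z : EuclideanSpace ℝ (ι₁ ⊕ ι₂) => prof (uPartL z) := (contDiff_prof (ι₂ := ι₂)).comp h0
  have h2 : ContDiff ℝ ∞ fun z : EuclideanSpace ℝ (ι₁ ⊕ ι₂) => joinE (sPartL z) (prof (uPartL z)) := by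
    have e1 : ∀ z : EuclideanSpace ℝ (ι₁ ⊕ ι₂), joinE (sPartL z) (prof (uPartL z)) =
        inlL (sPartL z) + (joinE 0 (prof (uPartL z))) := fun z => by
      rw [inlL_apply, joinE_add_joinE, add_zero, zero_add]
    have e2 : ContDiff ℝ ∞ fun b : EuclideanSpace ℝ ι₂ => (joinE (0 : EuclideanSpace ℝ ι₁) b) := by
      have : (fun b : EuclideanSpace ℝ ι₂ => joinE (0 : EuclideanSpace ℝ ι₁) b) =
          fun b => (EuclideanSpace.equiv (ι₁ ⊕ ι₂) ℝ).symm (fun i => Sum.elim (fun _ => (0 : ℝ))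
            (fun i' => EuclideanSpace.equiv ι₂ ℝ b i') i) := by
        funext b
        ext i
        cases i with
        | inl j => rfl
        | inr i => rfl
      rw [this]
      refine (EuclideanSpace.equiv (ι₁ ⊕ ι₂) ℝ).symm.contDiff.comp (contDiff_pi.2 fun i => ?_)
      cases i with
      | inl j => exact contDiff_const
      | inr i => exact (contDiff_apply ℝ ℝ i).comp (EuclideanSpace.equiv ι₂ ℝ).contDiff
    simp_rw [e1]
    exact ((inlL (ι₁ := ι₁) (ι₂ := ι₂)).contDiff.comp (sPartL (ι₁ := ι₁) (ι₂ := ι₂)).contDiff).add (e2.comp h1)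
  exact contDiff_const.add (Φ.contDiff.comp h2)

/-- **The chart is periodic up to the directions**: `Θ(z + e_{inl j}) = Θ(z) + dirVec Φ e_j`, `Θ(z + e_{inr i}) = Θ(z)`.
[cite: Freitag1990, Ch. III §2, p. 144] -/
private theorem dirChart_add_single (q₀ : P) (j : ι₁ ⊕ ι₂) (z : EuclideanSpace ℝ (ι₁ ⊕ ι₂)) :
    dirChart Φ q₀ (z + EuclideanSpace.single j (1 : ℝ)) =
      dirChart Φ q₀ z + dirVec Φ (Sum.elim (fun j' => EuclideanSpace.single j' (1 : ℝ)) (fun _ => 0) j) := by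
  cases j with
  | inl j =>
    have hs : sPartL (z + EuclideanSpace.single (Sum.inl j : ι₁ ⊕ ι₂) (1 : ℝ)) = sPartL z + EuclideanSpace.single j 1 := by
      rw [map_add, single_inl_eq, sPartL_joinE]
    have hu : uPartL (z + EuclideanSpace.single (Sum.inl j : ι₁ ⊕ ι₂) (1 : ℝ)) = uPartL z := by
      rw [map_add, single_inl_eq, uPartL_joinE, add_zero]
    simp only [dirChart, hs, hu, Sum.elim_inl, dirVec_apply]
    rw [add_assoc, ← map_add, joinE_add_joinE, add_zero]
  | inr i =>
    have hs : sPartL (z + EuclideanSpace.single (Sum.inr i : ι₁ ⊕ ι₂) (1 : ℝ)) = sPartL z := by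
      rw [map_add, single_inr_eq, sPartL_joinE, add_zero]
    have hu : uPartL (z + EuclideanSpace.single (Sum.inr i : ι₁ ⊕ ι₂) (1 : ℝ)) = uPartL z + EuclideanSpace.single i 1 := by
      rw [map_add, single_inr_eq, uPartL_joinE]
    simp only [dirChart, hs, hu, isLatticePeriodic_prof i (uPartL z), Sum.elim_inr, _root_.map_zero, add_zero]

/-- Hence `DΘ` is `ℤ^{ι₁ ⊕ ι₂}`-periodic. [folklore] -/
private theorem fderiv_dirChart_add_single (q₀ : P) (j : ι₁ ⊕ ι₂) (z : EuclideanSpace ℝ (ι₁ ⊕ ι₂)) :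
    _root_.fderiv ℝ (dirChart Φ q₀) (z + EuclideanSpace.single j (1 : ℝ)) = _root_.fderiv ℝ (dirChart Φ q₀) z := by
  rw [← fderiv_comp_add_right]
  simp_rw [dirChart_add_single]
  exact fderiv_add_const _

omit [Fintype ι₁] [DecidableEq ι₁] in
/-- **Near `u = 0` the chart is affine with linear part `Φ`**: `Θ(z) = q₀ + Φ z` for `‖u‖ ≤ 1/8`.
[cite: Freitag1990, Ch. III §2, p. 144] -/
private theorem dirChart_eq_of_norm_le (q₀ : P) {z : EuclideanSpace ℝ (ι₁ ⊕ ι₂)} (hz : ‖uPartL z‖ ≤ 1 / 8) :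
    dirChart Φ q₀ z = q₀ + Φ z := by
  rw [dirChart, prof_eq_self hz, joinE_sPartL_uPartL]

omit [Fintype ι₁] [DecidableEq ι₁] [DecidableEq ι₂] in
/-- The core `‖u‖ < 1/8` is open. [folklore] -/
private theorem isOpen_core : IsOpen {z : EuclideanSpace ℝ (ι₁ ⊕ ι₂) | ‖uPartL z‖ < 1 / 8} :=
  isOpen_lt (continuous_norm.comp (uPartL (ι₁ := ι₁) (ι₂ := ι₂)).continuous) continuous_const

omit [DecidableEq ι₁] in
/-- `DΘ = Φ` on the core. [folklore] -/
private theorem fderiv_dirChart_of_core (q₀ : P) {z : EuclideanSpace ℝ (ι₁ ⊕ ι₂)} (hz : ‖uPartL z‖ < 1 / 8) :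
    _root_.fderiv ℝ (dirChart Φ q₀) z = (Φ : EuclideanSpace ℝ (ι₁ ⊕ ι₂) →L[ℝ] P) := by
  have h : dirChart Φ q₀ =ᶠ[𝓝 z] fun z => q₀ + Φ z :=
    Filter.eventuallyEq_of_mem (isOpen_core.mem_nhds hz) fun z' hz' => dirChart_eq_of_norm_le Φ q₀ (le_of_lt hz')
  rw [h.fderiv_eq]
  exact ((Φ : EuclideanSpace ℝ (ι₁ ⊕ ι₂) →L[ℝ] P).hasFDerivAt.const_add q₀).fderiv

omit [DecidableEq ι₁] in
/-- Along a core fibre the chart is a translate of its base point by a direction: `Θ(a ⊕ u) = Θ(0 ⊕ u) + dirVec Φ a`.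
[cite: Freitag1990, Ch. III §2, p. 144] -/
private theorem dirChart_joinE_of_norm_le (q₀ : P) (a : EuclideanSpace ℝ ι₁) {u : EuclideanSpace ℝ ι₂} (hu : ‖u‖ ≤ 1 / 8) :
    dirChart Φ q₀ (joinE a u) = dirChart Φ q₀ (joinE 0 u) + dirVec Φ a := by
  rw [dirChart_eq_of_norm_le Φ q₀ (z := joinE a u) (by rwa [uPartL_joinE]),
    dirChart_eq_of_norm_le Φ q₀ (z := joinE 0 u) (by rwa [uPartL_joinE]), add_assoc, dirVec_apply, ← map_add,
    joinE_add_joinE, zero_add, add_zero]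

end Chart

/-! ## §5 The transported torus form and the identification of its fibre average and homotopy -/

section Transport

variable [DecidableEq ι₁] [DecidableEq ι₂]

section Algebra

variable {E₁ E₂ E₃ : Type*} [NormedAddCommGroup E₁] [NormedSpace ℝ E₁] [NormedAddCommGroup E₂] [NormedSpace ℝ E₂]
  [NormedAddCommGroup E₃] [NormedSpace ℝ E₃]

omit [Fintype ι₁] [Fintype ι₂] [DecidableEq ι₁] [DecidableEq ι₂] in
/-- `ι_a(β ∘ L) = (ι_{La} β) ∘ L`. [cite: BottTu1982Forms, §I.4] -/
private theorem curryLeft_compContinuousLinearMap_eq {q : ℕ} (β : E₂ [⋀^Fin (q + 1)]→L[ℝ] ℂ) (L : E₁ →L[ℝ] E₂) (a : E₁) :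
    (β.compContinuousLinearMap L).curryLeft a = (β.curryLeft (L a)).compContinuousLinearMap L := by
  ext v
  simp [ContinuousAlternatingMap.compContinuousLinearMap_apply]

omit [Fintype ι₁] [Fintype ι₂] [DecidableEq ι₁] [DecidableEq ι₂] in
/-- `(c β) ∘ L = c (β ∘ L)` for complex scalars. [folklore] -/
private theorem smul_compContinuousLinearMap_eq {q : ℕ} (c : ℂ) (β : E₂ [⋀^Fin q]→L[ℝ] ℂ) (L : E₁ →L[ℝ] E₂) :
    (c • β).compContinuousLinearMap L = c • β.compContinuousLinearMap L := by
  ext v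
  simp [ContinuousAlternatingMap.compContinuousLinearMap_apply]

omit [Fintype ι₁] [Fintype ι₂] [DecidableEq ι₁] [DecidableEq ι₂] in
/-- `(β ∘ L) ∘ L' = β ∘ (L L')`. [folklore] -/
private theorem compContinuousLinearMap_compContinuousLinearMap_eq {q : ℕ} (β : E₃ [⋀^Fin q]→L[ℝ] ℂ) (L : E₂ →L[ℝ] E₃)
    (L' : E₁ →L[ℝ] E₂) :
    (β.compContinuousLinearMap L).compContinuousLinearMap L' = β.compContinuousLinearMap (L.comp L') := by
  ext v
  simp [ContinuousAlternatingMap.compContinuousLinearMap_apply, Function.comp_def]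

omit [Fintype ι₁] [Fintype ι₂] [DecidableEq ι₁] [DecidableEq ι₂] in
/-- `β ∘ id = β`. [folklore] -/
private theorem compContinuousLinearMap_id_eq {q : ℕ} (β : E₁ [⋀^Fin q]→L[ℝ] ℂ) :
    β.compContinuousLinearMap (ContinuousLinearMap.id ℝ E₁) = β := by
  ext v
  simp [ContinuousAlternatingMap.compContinuousLinearMap_apply]

omit [Fintype ι₁] [Fintype ι₂] [DecidableEq ι₁] [DecidableEq ι₂] in
/-- `(β − β') ∘ L = β ∘ L − β' ∘ L`. [folklore] -/
private theorem sub_compContinuousLinearMap_eq {q : ℕ} (β β' : E₂ [⋀^Fin q]→L[ℝ] ℂ) (L : E₁ →L[ℝ] E₂) :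
    (β - β').compContinuousLinearMap L = β.compContinuousLinearMap L - β'.compContinuousLinearMap L := by
  ext v
  simp [ContinuousAlternatingMap.compContinuousLinearMap_apply]

omit [Fintype ι₁] [Fintype ι₂] [DecidableEq ι₁] [DecidableEq ι₂] in
/-- `0 ∘ L = 0`. [folklore] -/
private theorem zero_compContinuousLinearMap_eq {q : ℕ} (L : E₁ →L[ℝ] E₂) :
    (0 : E₂ [⋀^Fin q]→L[ℝ] ℂ).compContinuousLinearMap L = 0 := by
  ext v
  simp [ContinuousAlternatingMap.compContinuousLinearMap_apply]

omit [Fintype ι₁] [Fintype ι₂] [DecidableEq ι₁] [DecidableEq ι₂] in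
/-- Pull-back by a fixed linear map commutes with Bochner integrals. [folklore] -/
private theorem integral_compContinuousLinearMap [CompleteSpace E₁] [CompleteSpace E₂] {q : ℕ} {X : Type*} [MeasureSpace X]
    (L : E₁ →L[ℝ] E₂) {f : X → E₂ [⋀^Fin q]→L[ℝ] ℂ} (hf : Integrable f) :
    ∫ x, (f x).compContinuousLinearMap L = (∫ x, f x).compContinuousLinearMap L := by
  have := (ContinuousAlternatingMap.compContinuousLinearMapCLM (ι := Fin q) (F := ℂ) L :
    (E₂ [⋀^Fin q]→L[ℝ] ℂ) →L[ℝ] (E₁ [⋀^Fin q]→L[ℝ] ℂ)).integral_comp_comm hf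
  simpa only [ContinuousAlternatingMap.compContinuousLinearMapCLM_apply] using this

omit [Fintype ι₁] [Fintype ι₂] [DecidableEq ι₁] [DecidableEq ι₂] in
/-- `minSmoothness ℝ 2 ≤ ∞`. [folklore] -/
private theorem minSmoothness_two_le_infty : minSmoothness ℝ 2 ≤ ∞ := by
  rw [minSmoothness_of_isRCLikeNormedField]
  exact WithTop.coe_le_coe.mpr le_top

end Algebra

variable (Φ : EuclideanSpace ℝ (ι₁ ⊕ ι₂) ≃L[ℝ] P) [CompleteSpace P]

/-- **The pulled-back form `Θ^*η`** on `ℝ^{ι₁ ⊕ ι₂}`. [cite: BottTu1982Forms, §I.4] -/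
private def pullE {q : ℕ} (η : P → P [⋀^Fin q]→L[ℝ] ℂ) (q₀ : P) (z : EuclideanSpace ℝ (ι₁ ⊕ ι₂)) : DForm (ι₁ ⊕ ι₂) q :=
  (η (dirChart Φ q₀ z)).compContinuousLinearMap (_root_.fderiv ℝ (dirChart Φ q₀) z)

variable {Φ}

omit [DecidableEq ι₁] [CompleteSpace P] in
/-- `Θ^*η` is smooth. [cite: BottTu1982Forms, §I.4] -/
private theorem contDiff_pullE {q : ℕ} {η : P → P [⋀^Fin q]→L[ℝ] ℂ} (hηs : ContDiff ℝ ∞ η) (q₀ : P) :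
    ContDiff ℝ ∞ (pullE Φ η q₀) := by
  refine contDiff_iff_contDiffAt.2 fun z => ?_
  have h1 : ContDiffAt ℝ ∞ (fun z => η (dirChart Φ q₀ z)) z := (hηs.comp (contDiff_dirChart Φ q₀)).contDiffAt
  have h2 : ContDiffAt ℝ ∞ (_root_.fderiv ℝ (dirChart Φ q₀)) z :=
    (contDiff_infty_iff_fderiv.1 (contDiff_dirChart Φ q₀)).2.contDiffAt
  exact h1.continuousAlternatingMapCompContinuousLinearMap h2

omit [CompleteSpace P] in
/-- `Θ^*η` is `ℤ^{ι₁ ⊕ ι₂}`-periodic for direction-periodic `η`. [cite: Freitag1990, Ch. III §2, p. 144] -/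
private theorem isLatticePeriodic_pullE {q : ℕ} {η : P → P [⋀^Fin q]→L[ℝ] ℂ} (hη : IsDirPeriodic Φ η) (q₀ : P) :
    Torus.IsLatticePeriodic (pullE Φ η q₀) := by
  intro j z
  simp only [pullE]
  rw [fderiv_dirChart_add_single, dirChart_add_single]
  cases j with
  | inl j => rw [Sum.elim_inl, hη j]
  | inr i => rw [Sum.elim_inr, _root_.map_zero, add_zero]

variable (Φ) in
/-- **The torus form `G`**: the descent of `Θ^*η` to `T^{ι₁ ⊕ ι₂}`. [cite: Freitag1990, Ch. III §2, p. 144] -/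
private def torusForm {q : ℕ} {η : P → P [⋀^Fin q]→L[ℝ] ℂ} (hη : IsDirPeriodic Φ η) (q₀ : P) :
    UnitAddTorus (ι₁ ⊕ ι₂) → DForm (ι₁ ⊕ ι₂) q :=
  Torus.descend (pullE Φ η q₀) (isLatticePeriodic_pullE hη q₀)

omit [CompleteSpace P] in
/-- `lift G = Θ^*η`. [folklore] -/
private theorem lift_torusForm {q : ℕ} {η : P → P [⋀^Fin q]→L[ℝ] ℂ} (hη : IsDirPeriodic Φ η) (q₀ : P) :
    Torus.lift (torusForm Φ hη q₀) = pullE Φ η q₀ :=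
  Torus.lift_descend_holds _ _

omit [CompleteSpace P] in
/-- `G (proj z) = (Θ^*η)(z)`. [folklore] -/
private theorem torusForm_proj {q : ℕ} {η : P → P [⋀^Fin q]→L[ℝ] ℂ} (hη : IsDirPeriodic Φ η) (q₀ : P)
    (z : EuclideanSpace ℝ (ι₁ ⊕ ι₂)) : torusForm Φ hη q₀ (Torus.proj z) = pullE Φ η q₀ z := by
  rw [← Torus.lift_apply (torusForm Φ hη q₀), lift_torusForm]

omit [CompleteSpace P] in
/-- `G` is smooth. [folklore] -/
private theorem isSmooth_torusForm {q : ℕ} {η : P → P [⋀^Fin q]→L[ℝ] ℂ} (hηs : ContDiff ℝ ∞ η) (hη : IsDirPeriodic Φ η) (q₀ : P) :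
    Torus.IsSmooth (torusForm Φ hη q₀) := by
  unfold Torus.IsSmooth
  rw [lift_torusForm]
  exact contDiff_pullE hηs q₀

omit [CompleteSpace P] in
/-- **`G` is closed when `η` is.** [cite: BottTu1982Forms, §I.4 («`d` commutes with pullback»)] -/
private theorem extD_torusForm_eq_zero {q : ℕ} {η : P → P [⋀^Fin q]→L[ℝ] ℂ} (hηs : ContDiff ℝ ∞ η) (hη : IsDirPeriodic Φ η)
    (hd : ∀ w, extDeriv η w = 0) (q₀ : P) : Torus.extD (torusForm Φ hη q₀) = 0 := by
  funext x
  obtain ⟨z, rfl⟩ := Torus.proj_surjective x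
  rw [← Torus.extDeriv_lift, lift_torusForm, Pi.zero_apply]
  have hdiff : DifferentiableAt ℝ η (dirChart Φ q₀ z) := (hηs.differentiable (by simp)).differentiableAt
  show extDeriv (fun z => (η (dirChart Φ q₀ z)).compContinuousLinearMap (_root_.fderiv ℝ (dirChart Φ q₀) z)) z = 0
  rw [extDeriv_pullback hdiff (contDiff_dirChart Φ q₀).contDiffAt minSmoothness_two_le_infty, hd,
    zero_compContinuousLinearMap_eq]

/-- **The weight family in chart coordinates**: `W'_k = W_k ⊕ 0`. [cite: BottTu1982Forms, §I.4] -/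
private def liftWeight (W : (ι₁ → ℤ) → EuclideanSpace ℝ ι₁) (k : ι₁ → ℤ) : EuclideanSpace ℝ (ι₁ ⊕ ι₂) :=
  joinE (W k) 0

omit [DecidableEq ι₁] [DecidableEq ι₂] [CompleteSpace P] in
/-- `Φ (W'_k) = dirVec Φ W_k`. [folklore] -/
private theorem apply_liftWeight (W : (ι₁ → ℤ) → EuclideanSpace ℝ ι₁) (k : ι₁ → ℤ) : Φ (liftWeight W k) = dirVec Φ (W k) := rfl

omit [DecidableEq ι₁] [DecidableEq ι₂] in
/-- A normalised family lifts to a normalised family. [cite: BottTu1982Forms, §I.4] -/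
private theorem isNormalised_liftWeight {W : (ι₁ → ℤ) → EuclideanSpace ℝ ι₁} (hW : IsNormalisedWeight W) :
    Torus.IsNormalised (liftWeight (ι₂ := ι₂) W) := by
  intro k hk
  have key := hW.2 (k ∘ Sum.inl) hk
  have key' : (∑ j, ((k (Sum.inl j) : ℝ) : ℂ) * ((W (k ∘ Sum.inl) j : ℝ) : ℂ)) = 1 := by
    have := congrArg (fun r : ℝ => (r : ℂ)) key
    push_cast at this
    simpa using this
  rw [Torus.freqForm_apply, Fintype.sum_sum_type]
  simpa [liftWeight] using key'

omit [DecidableEq ι₁] [DecidableEq ι₂] in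
/-- A family of polynomial growth lifts to one. [folklore] -/
private theorem polyGrowth_liftWeight {W : (ι₁ → ℤ) → EuclideanSpace ℝ ι₁} (hW : HasPolyGrowthWeight W) :
    Torus.PolyGrowth (liftWeight (ι₂ := ι₂) W) := by
  obtain ⟨C, s, hCW⟩ := hW
  exact ⟨C, s, fun k => by rw [liftWeight, norm_joinE_zero]; exact hCW k⟩

/-- `K 0 = 0` for the torus homotopy. [cite: BottTu1982Forms, §I.4] -/
private theorem fibreHom_zero_apply {W : (ι₁ → ℤ) → EuclideanSpace ℝ ι₁} (hW : HasPolyGrowthWeight W) {q : ℕ}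
    (x : UnitAddTorus (ι₁ ⊕ ι₂)) :
    Torus.fibreHom (liftWeight (ι₂ := ι₂) W) (0 : UnitAddTorus (ι₁ ⊕ ι₂) → DForm (ι₁ ⊕ ι₂) (q + 1)) x = 0 := by
  rw [← Sum.elim_comp_inl_inr x]
  exact Torus.fibreHom_apply_eq_zero_of_forall (polyGrowth_liftWeight (ι₂ := ι₂) hW)
    (Torus.isSmooth_const (0 : DForm (ι₁ ⊕ ι₂) (q + 1))) (fun _ => rfl) _

omit [CompleteSpace P] in
/-- **The torus homotopy formula for `G`**: `d(K G) = G − A G`. [cite: BottTu1982Forms, §I.4] -/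
private theorem extD_fibreHom_torusForm {W : (ι₁ → ℤ) → EuclideanSpace ℝ ι₁} (hWn : IsNormalisedWeight W) (hWg : HasPolyGrowthWeight W)
    {p : ℕ} {η : P → P [⋀^Fin (p + 1)]→L[ℝ] ℂ} (hηs : ContDiff ℝ ∞ η) (hη : IsDirPeriodic Φ η) (hd : ∀ w, extDeriv η w = 0)
    (q₀ : P) (x : UnitAddTorus (ι₁ ⊕ ι₂)) :
    Torus.extD (Torus.fibreHom (liftWeight W) (torusForm Φ hη q₀)) x =
      torusForm Φ hη q₀ x - Torus.fibreAvg (torusForm Φ hη q₀) x := by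
  have hG := isSmooth_torusForm hηs hη q₀
  have h := congrFun (Torus.extD_fibreHom_add_fibreHom_extD (isNormalised_liftWeight hWn) (polyGrowth_liftWeight hWg) hG) x
  rwa [extD_torusForm_eq_zero hηs hη hd, fibreHom_zero_apply hWg, add_zero] at h

omit [CompleteSpace P] in
/-- **On a core fibre, `G` is the slice of `η` read through `Φ`**. [cite: Freitag1990, Ch. III §2, p. 145] -/
private theorem torusForm_fibre {q : ℕ} {η : P → P [⋀^Fin q]→L[ℝ] ℂ} (hη : IsDirPeriodic Φ η) (q₀ : P)
    {u : EuclideanSpace ℝ ι₂} (hu : ‖u‖ < 1 / 8) (t : UnitAddTorus ι₁) :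
    torusForm Φ hη q₀ (Sum.elim t (Torus.proj u)) =
      (dslice Φ η (dirChart Φ q₀ (joinE 0 u)) t).compContinuousLinearMap (Φ : EuclideanSpace ℝ (ι₁ ⊕ ι₂) →L[ℝ] P) := by
  have ht : (Sum.elim t (Torus.proj u) : UnitAddTorus (ι₁ ⊕ ι₂)) = Torus.proj (joinE (Torus.repr t) u) := by
    rw [proj_joinE, Torus.proj_repr]
  rw [ht, torusForm_proj, pullE, fderiv_dirChart_of_core Φ q₀ (z := joinE (Torus.repr t) u) (by rwa [uPartL_joinE]),
    dirChart_joinE_of_norm_le Φ q₀ (Torus.repr t) hu.le, dslice_apply]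

/-- **The fibre coefficients of `G` are the direction coefficients of `η`**. [cite: Grafakos2014, §3.1.1] -/
private theorem fibreCoeff_torusForm {q : ℕ} {η : P → P [⋀^Fin q]→L[ℝ] ℂ} (hηs : ContDiff ℝ ∞ η) (hη : IsDirPeriodic Φ η) (q₀ : P)
    {u : EuclideanSpace ℝ ι₂} (hu : ‖u‖ < 1 / 8) (k : ι₁ → ℤ) :
    Torus.fibreCoeff (torusForm Φ hη q₀) k (Torus.proj u) =
      (dcoeff Φ η k (dirChart Φ q₀ (joinE 0 u))).compContinuousLinearMap (Φ : EuclideanSpace ℝ (ι₁ ⊕ ι₂) →L[ℝ] P) := by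
  simp only [Torus.fibreCoeff, torusForm_fibre hη q₀ hu]
  rw [dcoeff, Torus.mFourierCoeff_eq_integral_volume]
  have hS : Continuous (dslice Φ η (dirChart Φ q₀ (joinE 0 u))) := (isSmooth_dslice hηs hη _).continuous
  have hint : Integrable (fun t => mFourier (-k) t • dslice Φ η (dirChart Φ q₀ (joinE 0 u)) t) :=
    ((mFourier (-k)).continuous.smul hS).integrable_unitAddTorus
  rw [← integral_compContinuousLinearMap _ hint]
  simp only [smul_compContinuousLinearMap_eq]

/-- **The fibre average of `G` is the direction average of `η`** read through `Φ`, on the core.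
[cite: Freitag1990, Ch. III §2, p. 145] -/
private theorem fibreAvg_torusForm {q : ℕ} {η : P → P [⋀^Fin q]→L[ℝ] ℂ} (hηs : ContDiff ℝ ∞ η) (hη : IsDirPeriodic Φ η) (q₀ : P)
    {z : EuclideanSpace ℝ (ι₁ ⊕ ι₂)} (hz : ‖uPartL z‖ < 1 / 8) :
    Torus.fibreAvg (torusForm Φ hη q₀) (Torus.proj z) =
      (davg Φ η (dirChart Φ q₀ z)).compContinuousLinearMap (Φ : EuclideanSpace ℝ (ι₁ ⊕ ι₂) →L[ℝ] P) := by
  have hG := isSmooth_torusForm hηs hη q₀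
  have hS : Continuous (dslice Φ η (dirChart Φ q₀ (joinE 0 (uPartL z)))) := (isSmooth_dslice hηs hη _).continuous
  rw [← joinE_sPartL_uPartL z, proj_joinE, Torus.fibreAvg_apply hG]
  simp only [torusForm_fibre hη q₀ hz]
  rw [integral_compContinuousLinearMap _ hS.integrable_unitAddTorus,
    show (∫ t, dslice Φ η (dirChart Φ q₀ (joinE 0 (uPartL z))) t) = davg Φ η (dirChart Φ q₀ (joinE 0 (uPartL z))) from rfl,
    dirChart_joinE_of_norm_le Φ q₀ (sPartL z) hz.le, davg_add_dirVec hη]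

/-- The terms `k ≠ 0` of the fibre homotopy of `G` are the terms of `dhom` read through `Φ`. [cite: BottTu1982Forms, §I.4] -/
private theorem dhomTerm_eq_of_fibre (W : (ι₁ → ℤ) → EuclideanSpace ℝ ι₁) {p : ℕ}
    {η : P → P [⋀^Fin (p + 1)]→L[ℝ] ℂ} (hηs : ContDiff ℝ ∞ η) (hη : IsDirPeriodic Φ η) (q₀ : P)
    {z : EuclideanSpace ℝ (ι₁ ⊕ ι₂)} (hz : ‖uPartL z‖ < 1 / 8) (k : ι₁ → ℤ) :
    mFourier k (Torus.proj (sPartL z)) •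
        ((2 * Real.pi * I : ℂ)⁻¹ •
          (Torus.fibreCoeff (torusForm Φ hη q₀) k (Torus.proj (uPartL z))).curryLeft (liftWeight W k)) =
      (dhomTerm Φ W η k (dirChart Φ q₀ z)).compContinuousLinearMap (Φ : EuclideanSpace ℝ (ι₁ ⊕ ι₂) →L[ℝ] P) := by
  have hzw : dirChart Φ q₀ z = dirChart Φ q₀ (joinE 0 (uPartL z)) + dirVec Φ (sPartL z) := by
    conv_lhs => rw [← joinE_sPartL_uPartL z]
    exact dirChart_joinE_of_norm_le Φ q₀ (sPartL z) hz.le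
  rw [fibreCoeff_torusForm hηs hη q₀ hz k, curryLeft_compContinuousLinearMap_eq]
  change _ = (dhomTerm Φ W η k (dirChart Φ q₀ z)).compContinuousLinearMap _
  rw [show ((Φ : EuclideanSpace ℝ (ι₁ ⊕ ι₂) →L[ℝ] P) (liftWeight W k)) = dirVec Φ (W k) from rfl, dhomTerm, hzw,
    dcoeff_add_dirVec hη, curryLeft_smul', ← smul_compContinuousLinearMap_eq, ← smul_compContinuousLinearMap_eq]
  congr 1
  exact smul_comm _ _ _

/-- **The fibre homotopy of `G` is the direction homotopy of `η`** read through `Φ`, on the core.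
[cite: BottTu1982Forms, §I.4] -/
private theorem fibreHom_torusForm {W : (ι₁ → ℤ) → EuclideanSpace ℝ ι₁} (hWn : IsNormalisedWeight W) (hWg : HasPolyGrowthWeight W)
    {p : ℕ} {η : P → P [⋀^Fin (p + 1)]→L[ℝ] ℂ} (hηs : ContDiff ℝ ∞ η) (hη : IsDirPeriodic Φ η) (q₀ : P)
    {z : EuclideanSpace ℝ (ι₁ ⊕ ι₂)} (hz : ‖uPartL z‖ < 1 / 8) :
    Torus.fibreHom (liftWeight W) (torusForm Φ hη q₀) (Torus.proj z) =
      (dhom Φ W η (dirChart Φ q₀ z)).compContinuousLinearMap (Φ : EuclideanSpace ℝ (ι₁ ⊕ ι₂) →L[ℝ] P) := by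
  have hG := isSmooth_torusForm hηs hη q₀
  have hterm : ∀ k : ι₁ → ℤ, mFourier k (Torus.proj (sPartL z)) •
      (if k = 0 then (0 : DForm (ι₁ ⊕ ι₂) p)
        else (2 * Real.pi * I : ℂ)⁻¹ •
          (Torus.fibreCoeff (torusForm Φ hη q₀) k (Torus.proj (uPartL z))).curryLeft (liftWeight W k)) =
      (dhomTerm Φ W η k (dirChart Φ q₀ z)).compContinuousLinearMap (Φ : EuclideanSpace ℝ (ι₁ ⊕ ι₂) →L[ℝ] P) := by
    intro k
    by_cases hk : k = 0
    · subst hk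
      rw [if_pos rfl, smul_zero, dhomTerm_zero hWn.1, zero_compContinuousLinearMap_eq]
    · rw [if_neg hk]
      exact dhomTerm_eq_of_fibre W hηs hη q₀ hz k
  rw [← joinE_sPartL_uPartL z, proj_joinE, Torus.fibreHom_apply (polyGrowth_liftWeight hWg) hG, joinE_sPartL_uPartL]
  calc ∑' k : ι₁ → ℤ, mFourier k (Torus.proj (sPartL z)) •
        (if k = 0 then (0 : DForm (ι₁ ⊕ ι₂) p)
          else (2 * Real.pi * I : ℂ)⁻¹ •
            (Torus.fibreCoeff (torusForm Φ hη q₀) k (Torus.proj (uPartL z))).curryLeft (liftWeight W k))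
      = ∑' k, (dhomTerm Φ W η k (dirChart Φ q₀ z)).compContinuousLinearMap (Φ : EuclideanSpace ℝ (ι₁ ⊕ ι₂) →L[ℝ] P) :=
        tsum_congr hterm
    _ = (dhom Φ W η (dirChart Φ q₀ z)).compContinuousLinearMap (Φ : EuclideanSpace ℝ (ι₁ ⊕ ι₂) →L[ℝ] P) := by
      have hs := summable_dhomTerm hWg hηs hη (dirChart Φ q₀ z)
      have := (ContinuousAlternatingMap.compContinuousLinearMapCLM (ι := Fin p) (F := ℂ)
        (Φ : EuclideanSpace ℝ (ι₁ ⊕ ι₂) →L[ℝ] P) : (P [⋀^Fin p]→L[ℝ] ℂ) →L[ℝ] DForm (ι₁ ⊕ ι₂) p).map_tsum hs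
      simp only [ContinuousAlternatingMap.compContinuousLinearMapCLM_apply] at this
      rw [dhom, this]

end Transport

/-! ## §6 Smoothness of `davg`, `dhom` and the homotopy formula `d(dhom η) = η − davg η` -/

section Main

variable [DecidableEq ι₁] [DecidableEq ι₂] {Φ : EuclideanSpace ℝ (ι₁ ⊕ ι₂) ≃L[ℝ] P} [CompleteSpace P]

omit [DecidableEq ι₁] [CompleteSpace P] in
/-- **Push-forward through the affine core**: if a smooth `Ψ'` on `ℝ^{ι₁ ⊕ ι₂}` agrees on the core with `(f ∘ Θ) ∘ Φ`, then
`f` is smooth at every `w` with `Φ⁻¹(w − q₀)` in the core and `df(w) = dΨ'(Φ⁻¹(w − q₀)) ∘ Φ⁻¹`.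
[cite: BottTu1982Forms, §I.4 («`d` commutes with pullback»)] -/
private theorem pushforward_of_core (q₀ : P) {q : ℕ} {Ψ' : EuclideanSpace ℝ (ι₁ ⊕ ι₂) → DForm (ι₁ ⊕ ι₂) q} (hΨ : ContDiff ℝ ∞ Ψ')
    {f : P → P [⋀^Fin q]→L[ℝ] ℂ}
    (hf : ∀ z, ‖uPartL z‖ < 1 / 8 → Ψ' z = (f (dirChart Φ q₀ z)).compContinuousLinearMap (Φ : EuclideanSpace ℝ (ι₁ ⊕ ι₂) →L[ℝ] P))
    {w : P} (hw : ‖uPartL (Φ.symm (w - q₀))‖ < 1 / 8) :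
    ContDiffAt ℝ ∞ f w ∧ extDeriv f w =
      (extDeriv Ψ' (Φ.symm (w - q₀))).compContinuousLinearMap (Φ.symm : P →L[ℝ] EuclideanSpace ℝ (ι₁ ⊕ ι₂)) := by
  set Ψ : P → EuclideanSpace ℝ (ι₁ ⊕ ι₂) := fun w => Φ.symm (w - q₀) with hΨdef
  have hΨd : ∀ w', HasFDerivAt Ψ (Φ.symm : P →L[ℝ] EuclideanSpace ℝ (ι₁ ⊕ ι₂)) w' := fun w' => by
    have h := (Φ.symm : P →L[ℝ] EuclideanSpace ℝ (ι₁ ⊕ ι₂)).hasFDerivAt.comp w' ((hasFDerivAt_id w').sub_const q₀)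
    rw [ContinuousLinearMap.comp_id] at h
    exact h
  have hΨs : ContDiff ℝ ∞ Ψ := Φ.symm.contDiff.comp (contDiff_id.sub contDiff_const)
  have hchart : ∀ w', ‖uPartL (Ψ w')‖ < 1 / 8 → dirChart Φ q₀ (Ψ w') = w' := fun w' hw' => by
    rw [dirChart_eq_of_norm_le Φ q₀ hw'.le]
    show q₀ + Φ (Φ.symm (w' - q₀)) = w'
    rw [Φ.apply_symm_apply]
    abel
  have hU : IsOpen {w' : P | ‖uPartL (Ψ w')‖ < 1 / 8} :=
    isOpen_lt (continuous_norm.comp ((uPartL (ι₁ := ι₁) (ι₂ := ι₂)).continuous.comp hΨs.continuous)) continuous_const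
  have hg : ∀ w' ∈ {w' : P | ‖uPartL (Ψ w')‖ < 1 / 8},
      f w' = (Ψ' (Ψ w')).compContinuousLinearMap (_root_.fderiv ℝ Ψ w') := fun w' hw' => by
    rw [(hΨd w').fderiv, hf _ hw', hchart w' hw', compContinuousLinearMap_compContinuousLinearMap_eq,
      ContinuousLinearEquiv.coe_comp_coe_symm, compContinuousLinearMap_id_eq]
  have hev : f =ᶠ[𝓝 w] fun w' => (Ψ' (Ψ w')).compContinuousLinearMap (_root_.fderiv ℝ Ψ w') :=
    Filter.eventuallyEq_of_mem (hU.mem_nhds hw) hg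
  have hsmooth : ContDiffAt ℝ ∞ (fun w' => (Ψ' (Ψ w')).compContinuousLinearMap (_root_.fderiv ℝ Ψ w')) w := by
    have h1 : ContDiffAt ℝ ∞ (fun w' => Ψ' (Ψ w')) w := (hΨ.comp hΨs).contDiffAt
    have h2 : ContDiffAt ℝ ∞ (_root_.fderiv ℝ Ψ) w := by
      have : _root_.fderiv ℝ Ψ = fun _ => (Φ.symm : P →L[ℝ] EuclideanSpace ℝ (ι₁ ⊕ ι₂)) :=
        funext fun w' => (hΨd w').fderiv
      rw [this]
      exact contDiffAt_const
    exact h1.continuousAlternatingMapCompContinuousLinearMap h2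
  refine ⟨hsmooth.congr_of_eventuallyEq hev, ?_⟩
  rw [hev.extDeriv_eq, extDeriv_pullback (hΨ.differentiable (by simp)).differentiableAt hΨs.contDiffAt
    minSmoothness_two_le_infty, (hΨd w).fderiv]

omit [Fintype ι₁] [DecidableEq ι₁] [DecidableEq ι₂] [CompleteSpace P] in
/-- With the chart based at `w` itself, `w` lies over the centre of the core. [folklore] -/
private theorem norm_uPartL_symm_sub_self (w : P) : ‖uPartL (Φ.symm (w - w))‖ < 1 / 8 := by
  rw [sub_self, _root_.map_zero, _root_.map_zero, norm_zero]
  norm_num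

/-- **`dhom Φ W η` is `C^∞`** for a smooth direction-periodic `(p+1)`-form `η`. [cite: BottTu1982Forms, §I.4] -/
theorem contDiff_dhom {W : (ι₁ → ℤ) → EuclideanSpace ℝ ι₁} (hWn : IsNormalisedWeight W) (hWg : HasPolyGrowthWeight W) {p : ℕ}
    {η : P → P [⋀^Fin (p + 1)]→L[ℝ] ℂ} (hηs : ContDiff ℝ ∞ η) (hη : IsDirPeriodic Φ η) : ContDiff ℝ ∞ (dhom Φ W η) := by
  refine contDiff_iff_contDiffAt.2 fun w => ?_
  have hG := isSmooth_torusForm hηs hη w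
  exact (pushforward_of_core w (hG.fibreHom (polyGrowth_liftWeight hWg))
    (fun z hz => by rw [Torus.lift_apply]; exact fibreHom_torusForm hWn hWg hηs hη w hz) (norm_uPartL_symm_sub_self w)).1

/-- **`davg Φ η` is `C^∞`** for a smooth direction-periodic form `η`. [cite: Freitag1990, Ch. III §2, p. 145] -/
theorem contDiff_davg {q : ℕ} {η : P → P [⋀^Fin q]→L[ℝ] ℂ} (hηs : ContDiff ℝ ∞ η) (hη : IsDirPeriodic Φ η) :
    ContDiff ℝ ∞ (davg Φ η) := by
  refine contDiff_iff_contDiffAt.2 fun w => ?_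
  have hG := isSmooth_torusForm hηs hη w
  exact (pushforward_of_core w hG.fibreAvg
    (fun z hz => by rw [Torus.lift_apply]; exact fibreAvg_torusForm hηs hη w hz) (norm_uPartL_symm_sub_self w)).1

/-- **THE HOMOTOPY FORMULA `d(dhom Φ W η) = η − davg Φ η`** for a smooth, CLOSED, direction-periodic `(p+1)`-form `η`:
the non-constant Fourier modes along the directions are exact, by an explicit direction-periodic smooth primitive.
[cite: BottTu1982Forms, §I.4] [cite: Freitag1990, Ch. III §2, proof of Prop. 2.1, pp. 144–145] -/
theorem extDeriv_dhom {W : (ι₁ → ℤ) → EuclideanSpace ℝ ι₁} (hWn : IsNormalisedWeight W) (hWg : HasPolyGrowthWeight W) {p : ℕ}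
    {η : P → P [⋀^Fin (p + 1)]→L[ℝ] ℂ} (hηs : ContDiff ℝ ∞ η) (hη : IsDirPeriodic Φ η) (hd : ∀ w, extDeriv η w = 0)
    (w : P) : extDeriv (dhom Φ W η) w = η w - davg Φ η w := by
  have hG := isSmooth_torusForm hηs hη w
  have hcore := norm_uPartL_symm_sub_self (Φ := Φ) w
  have hzw : dirChart Φ w (Φ.symm (w - w)) = w := by
    rw [dirChart_eq_of_norm_le Φ w hcore.le]
    simp
  rw [(pushforward_of_core w (hG.fibreHom (polyGrowth_liftWeight hWg))
    (fun z hz => by rw [Torus.lift_apply]; exact fibreHom_torusForm hWn hWg hηs hη w hz) hcore).2,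
    Torus.extDeriv_lift, extD_fibreHom_torusForm hWn hWg hηs hη hd, torusForm_proj,
    fibreAvg_torusForm hηs hη w hcore, pullE, fderiv_dirChart_of_core Φ w hcore, hzw,
    ← sub_compContinuousLinearMap_eq, compContinuousLinearMap_compContinuousLinearMap_eq,
    ContinuousLinearEquiv.coe_comp_coe_symm, compContinuousLinearMap_id_eq]

end Main

/-! ## §7 Equivariance under affine maps whose linear part fixes the directions -/

section Equivariance

variable [DecidableEq ι₁] {Φ : EuclideanSpace ℝ (ι₁ ⊕ ι₂) ≃L[ℝ] P} [CompleteSpace P]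
variable {D : P →L[ℝ] P} {c : P}

omit [DecidableEq ι₁] [CompleteSpace P] in
/-- The slice transforms by `D`: `dslice η q = dslice η (Dq + c) ∘ D` when `η(q) = η(Dq + c) ∘ D` and `D` fixes the
directions. [cite: Freitag1990, Ch. III §2, p. 145 («invariant under `z ↦ εz + b`»)] -/
theorem dslice_eq_comp_of_invariant {q' : ℕ} {η : P → P [⋀^Fin q']→L[ℝ] ℂ} (hD : ∀ s, D (dirVec Φ s) = dirVec Φ s)
    (hinv : ∀ q, η q = (η (D q + c)).compContinuousLinearMap D) (q : P) :
    dslice Φ η q = fun t => (dslice Φ η (D q + c) t).compContinuousLinearMap D := by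
  funext t
  rw [dslice_apply, dslice_apply, hinv, map_add, hD, add_right_comm]

/-- **The direction average is equivariant**: `davg η q = davg η (Dq + c) ∘ D`. [cite: Freitag1990, Ch. III §2, p. 145] -/
theorem davg_eq_comp_of_invariant {q' : ℕ} {η : P → P [⋀^Fin q']→L[ℝ] ℂ} (hηs : ContDiff ℝ ∞ η) (hη : IsDirPeriodic Φ η)
    (hD : ∀ s, D (dirVec Φ s) = dirVec Φ s) (hinv : ∀ q, η q = (η (D q + c)).compContinuousLinearMap D) (q : P) :
    davg Φ η q = (davg Φ η (D q + c)).compContinuousLinearMap D := by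
  have hS : Continuous (dslice Φ η (D q + c)) := (isSmooth_dslice hηs hη _).continuous
  rw [davg, dslice_eq_comp_of_invariant hD hinv q, integral_compContinuousLinearMap _ hS.integrable_unitAddTorus]
  rfl

/-- **The coefficients are equivariant**: `dcoeff η k q = dcoeff η k (Dq + c) ∘ D`. [cite: Freitag1990, Ch. III §2, p. 145] -/
theorem dcoeff_eq_comp_of_invariant {q' : ℕ} {η : P → P [⋀^Fin q']→L[ℝ] ℂ} (hηs : ContDiff ℝ ∞ η) (hη : IsDirPeriodic Φ η)
    (hD : ∀ s, D (dirVec Φ s) = dirVec Φ s) (hinv : ∀ q, η q = (η (D q + c)).compContinuousLinearMap D)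
    (k : ι₁ → ℤ) (q : P) : dcoeff Φ η k q = (dcoeff Φ η k (D q + c)).compContinuousLinearMap D := by
  have hS : Continuous (dslice Φ η (D q + c)) := (isSmooth_dslice hηs hη _).continuous
  have hint : Integrable (fun t => mFourier (-k) t • dslice Φ η (D q + c) t) :=
    ((mFourier (-k)).continuous.smul hS).integrable_unitAddTorus
  simp only [dcoeff, Torus.mFourierCoeff_eq_integral_volume]
  rw [dslice_eq_comp_of_invariant hD hinv q, ← integral_compContinuousLinearMap _ hint]
  simp only [smul_compContinuousLinearMap_eq]

/-- **The homotopy terms are equivariant** (`D` fixes `dirVec Φ W_k`). [cite: BottTu1982Forms, §I.4] -/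
theorem dhomTerm_eq_comp_of_invariant (W : (ι₁ → ℤ) → EuclideanSpace ℝ ι₁) {p : ℕ} {η : P → P [⋀^Fin (p + 1)]→L[ℝ] ℂ}
    (hηs : ContDiff ℝ ∞ η) (hη : IsDirPeriodic Φ η) (hD : ∀ s, D (dirVec Φ s) = dirVec Φ s)
    (hinv : ∀ q, η q = (η (D q + c)).compContinuousLinearMap D) (k : ι₁ → ℤ) (q : P) :
    dhomTerm Φ W η k q = (dhomTerm Φ W η k (D q + c)).compContinuousLinearMap D := by
  rw [dhomTerm, dhomTerm, dcoeff_eq_comp_of_invariant hηs hη hD hinv k q, curryLeft_compContinuousLinearMap_eq, hD,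
    smul_compContinuousLinearMap_eq]

/-- **The homotopy is equivariant**: `dhom η q = dhom η (Dq + c) ∘ D`. [cite: Freitag1990, Ch. III §2, proof of Prop. 2.1, p. 145] -/
theorem dhom_eq_comp_of_invariant {W : (ι₁ → ℤ) → EuclideanSpace ℝ ι₁} (hWg : HasPolyGrowthWeight W) {p : ℕ}
    {η : P → P [⋀^Fin (p + 1)]→L[ℝ] ℂ} (hηs : ContDiff ℝ ∞ η) (hη : IsDirPeriodic Φ η)
    (hD : ∀ s, D (dirVec Φ s) = dirVec Φ s) (hinv : ∀ q, η q = (η (D q + c)).compContinuousLinearMap D) (q : P) :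
    dhom Φ W η q = (dhom Φ W η (D q + c)).compContinuousLinearMap D := by
  have hs := summable_dhomTerm hWg hηs hη (D q + c)
  have := (ContinuousAlternatingMap.compContinuousLinearMapCLM (ι := Fin p) (F := ℂ) D :
    (P [⋀^Fin p]→L[ℝ] ℂ) →L[ℝ] (P [⋀^Fin p]→L[ℝ] ℂ)).map_tsum hs
  simp only [ContinuousAlternatingMap.compContinuousLinearMapCLM_apply] at this
  rw [dhom, dhom, this]
  exact tsum_congr fun k => dhomTerm_eq_comp_of_invariant W hηs hη hD hinv k q

end Equivariance

end Torus

end Literature.Analysis.FunctionSpaces
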